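import Summits.CriticalPhenomena.PercolationContinuityZ3.Theses.PercNearOneGluingNoHeavy
import Summits.CriticalPhenomena.PercolationContinuityZ3.Theorems.PercNearOneGluingNoHeavyLowerTailFatMinorityReductions
import HarnessLib

/-!
# `NoHeavyLowerTail` (stmt-CriticalPhenomena-4575) — the RELAXED pre-FKG inequality (Kozma–Nitzan Conjecture 2 with a
# constant) suffices for the crux

Support file (lemma factory `prim-lf-1` gen 9; `--supports stmt-CriticalPhenomena-4575`).  No definitions, no named facts, no
sorries.

Kozma–Nitzan's pre-FKG Conjecture 2 (arXiv:2401.12397, (3) p. 3) asks for SOME relay `a ∈ A` with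
`P(a ↔ b, o ↔ A) ≤ P(o ↔ b)`, i.e. `P(o ↔ A) − P(o ↔ b) ≤ P(a ↮ b, o ↔ A)`.  The C-relaxed exploration certificate of
memo FROM-prim-lf-1-gen9.md (EC^C, HOME/EC-NOTE.md §9) certifies the weaker inequality with a constant,
`P(o ↔ A) − P(o ↔ b) ≤ C · P(a ↮ b, o ↔ A)`, which is all the crux needs: it gives linear gluing
`P(o ↮ b) ≤ (C+1)·(P(o ↮ A) + max_{a,a'} P(a ↮ a'))` and hence `NoHeavyLowerTail` through the landed
`noHeavyLowerTail_of_linearGluing` (fat-minority reductions).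

* `linearGluing_of_relaxedPreFKG` — the one-line bookkeeping.
* `noHeavyLowerTail_of_relaxedPreFKG` — the socket: the relaxed Conjecture 2 with any constant `C ≥ 0` implies the crux.
[cite: KozmaNitzan2024, Conjecture 2 and (3) (p. 3), Question 9 (p. 36)]
-/

noncomputable section

namespace Summit.CriticalPhenomena.PercolationContinuityZ3.Theorems

open MeasureTheory Set Literature.Probability.LatticeModels Literature.Probability.Percolation
open scoped Classical BigOperators

/-- **Relaxed pre-FKG ⟹ linear gluing.**  If for the target `b ∈ A` some relay `a ∈ A` satisfies
`P(o ↔ A) − P(o ↔ b) ≤ C · P(a ↮ b, o ↔ A)`, and all relay pairs are `η`-reliable, then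
`P(o ↮ b) ≤ (C + 1) · (P(o ↮ A) + η)`. [cite: KozmaNitzan2024, Conjecture 2 (p. 3)] -/
theorem linearGluing_of_relaxedPreFKG {C : ℝ} (hC : 0 ≤ C) {n : ℕ} (w : Sym2 (Fin n) → unitInterval)
    (A : Finset (Fin n)) (o b : Fin n) (η : ℝ) (hη : 0 ≤ η) (hb : b ∈ A)
    (hpair : ∀ a ∈ A, ∀ a' ∈ A, (prodBernoulli w).real (openConn a a' : Set (BondConfig (Fin n)))ᶜ ≤ η)
    (hrel : ∃ a ∈ A, (prodBernoulli w).real (⋃ x ∈ A, (openConn o x : Set (BondConfig (Fin n)))) -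
        (prodBernoulli w).real (openConn o b : Set (BondConfig (Fin n))) ≤
      C * (prodBernoulli w).real ((openConn a b : Set (BondConfig (Fin n)))ᶜ ∩ ⋃ x ∈ A, openConn o x)) :
    (prodBernoulli w).real (openConn o b : Set (BondConfig (Fin n)))ᶜ ≤
      (C + 1) * ((prodBernoulli w).real (⋃ x ∈ A, (openConn o x : Set (BondConfig (Fin n))))ᶜ + η) := by
  obtain ⟨a, ha, hle⟩ := hrel
  have hmeas : ∀ s : Set (BondConfig (Fin n)), MeasurableSet s := fun _ => MeasurableSet.of_discrete
  have h1 : (prodBernoulli w).real ((openConn a b : Set (BondConfig (Fin n)))ᶜ ∩ ⋃ x ∈ A, openConn o x) ≤ η :=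
    (measureReal_mono inter_subset_left).trans (hpair a ha b hb)
  have hU : (prodBernoulli w).real (⋃ x ∈ A, (openConn o x : Set (BondConfig (Fin n))))ᶜ =
      1 - (prodBernoulli w).real (⋃ x ∈ A, (openConn o x : Set (BondConfig (Fin n)))) :=
    probReal_compl_eq_one_sub (hmeas _)
  have hB : (prodBernoulli w).real (openConn o b : Set (BondConfig (Fin n)))ᶜ =
      1 - (prodBernoulli w).real (openConn o b : Set (BondConfig (Fin n))) :=
    probReal_compl_eq_one_sub (hmeas _)
  have h0 : 0 ≤ (prodBernoulli w).real (⋃ x ∈ A, (openConn o x : Set (BondConfig (Fin n))))ᶜ :=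
    measureReal_nonneg
  have h2 : C * (prodBernoulli w).real ((openConn a b : Set (BondConfig (Fin n)))ᶜ ∩ ⋃ x ∈ A, openConn o x) ≤
      C * η := mul_le_mul_of_nonneg_left h1 hC
  rw [hB, hU]
  nlinarith

/-- **Socket: the relaxed Conjecture 2 (any constant `C ≥ 0`) ⟹ the crux `NoHeavyLowerTail`** (through linear gluing
and the landed fat-minority reductions `noHeavyLowerTail_of_linearGluing`).  With `C = 1` the hypothesis is
Kozma–Nitzan's Conjecture 2 in form (3) for `b ∈ A`. [cite: KozmaNitzan2024, Conjecture 2 and (3) (p. 3)] -/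
theorem noHeavyLowerTail_of_relaxedPreFKG (C : ℝ) (hC : 0 ≤ C)
    (hrel : ∀ (n : ℕ) (w : Sym2 (Fin n) → unitInterval) (A : Finset (Fin n)) (o b : Fin n), o ∉ A → b ∈ A →
      ∃ a ∈ A, (prodBernoulli w).real (⋃ x ∈ A, (openConn o x : Set (BondConfig (Fin n)))) -
          (prodBernoulli w).real (openConn o b : Set (BondConfig (Fin n))) ≤
        C * (prodBernoulli w).real ((openConn a b : Set (BondConfig (Fin n)))ᶜ ∩ ⋃ x ∈ A, openConn o x)) :
    Summit.CriticalPhenomena.PercolationContinuityZ3.Theses.PercNearOneGluingNoHeavy.NoHeavyLowerTail :=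
  noHeavyLowerTail_of_linearGluing ⟨C + 1, by linarith, fun n w A o a₀ η hη hoA ha₀ hpair =>
    linearGluing_of_relaxedPreFKG hC w A o a₀ η hη ha₀ hpair (hrel n w A o a₀ hoA ha₀)⟩

end Summit.CriticalPhenomena.PercolationContinuityZ3.Theorems

end
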